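import Mathlib
import HarnessLib
import Summits.FinalStateConjecture.FinalStateConjecture.Theorems.ZeroEnergyKerrOrBombKerrModeStabilityGrowthIdentity

/-!
# Route ZeroEnergyKerrOrBomb · item `KerrModeStability` — polynomial growth of the slice energy
# of a bounded Killing-mode pair

Helper file for item stmt-FinalStateConjecture-10024 (`KerrModeStability`). For a smooth
Killing-mode pair `(ψ, χ)` on a horizon-penetrating Kerr–Schild chart which is bounded on
`{r > r₊, t* ≤ 0}`, the coordinate energy of the pair through the exterior part of the ball
`{‖y‖ ≤ R}` of the leaf `{t* = 0}` grows at most like `R³` (`kerrModePair_sliceEnergy_growth`):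
near the hole the density is bounded (continuity on a compact set), and in the far region the
cut-off energy bound `kerrModePair_cutoff_energy_le` (the Lagrangian identity, where the
boundedness of the pair enters) controls it by a constant times the volume of the ball of radius
`R + 2`. This is the last ingredient of the energy-growth contradiction proving the item from the
boundedness theorem of Dafermos–Rodnianski–Shlapentokh-Rothman. No new definitions.
-/

noncomputable section

namespace Summit.FinalStateConjecture.FinalStateConjecture.Theorems

open Literature.Geometry.Lorentzian Set Filter MeasureTheory
open scoped Manifold ContDiff Topology ENNReal

-- every `Summit.FinalStateConjecture.FinalStateConjecture.…` name repeats the summit = sub-problem segment (D-0017 layout)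
set_option linter.dupNamespace false

/-- `(R + 2)³ ≤ 27 R³ + 27` for `R ≥ 0`. -/
theorem kerr_add_two_pow_three_le {R : ℝ} (hR : 0 ≤ R) : (R + 2) ^ 3 ≤ 27 * R ^ 3 + 27 := by
  rcases le_or_gt R 1 with h | h
  · have : R + 2 ≤ 3 := by linarith
    have h3 : (R + 2) ^ 3 ≤ 3 ^ 3 := pow_le_pow_left₀ (by linarith) this 3
    nlinarith [pow_nonneg hR 3]
  · have : R + 2 ≤ 3 * R := by linarith
    have h3 : (R + 2) ^ 3 ≤ (3 * R) ^ 3 := pow_le_pow_left₀ (by linarith) this 3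
    nlinarith

-- one long bookkeeping proof (near-zone compactness bound, far-zone cut-off bound, conversion
-- between Lebesgue and Bochner integrals); the default budget is exceeded by accumulated elaboration
set_option maxHeartbeats 800000 in
/-- **Polynomial growth of the slice energy of a bounded Killing-mode pair.** Let `(M, a)` be
subextremal, `r₋ < r₀ < r₊`, and `(ψ, χ)` a smooth pair on `Kerr.region a r₀` with `□ψ = □χ = 0`,
`∂₀ψ = νψ − ωχ`, `∂₀χ = ωψ + νχ` on `{r > r₊}` and `|ψ|, |χ| ≤ C_b` on `{r > r₊, t* ≤ 0}`. Then there
are `A, B ≥ 0` with `∫_{‖y‖ ≤ R, r > r₊} (e_ψ + e_χ)(0, y) dy ≤ A R³ + B` for all `R ≥ 0`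
(coordinate energy densities of `WeightedNorms.lean`). Proof: on `{‖y‖ ≤ R_far + 2, r ≥ r₊}`
(compact, inside the chart) the continuous density is bounded by some `B₀`; beyond, the annular
cut-off `ζ_R` of `kerrModePair_cutoff_energy_le` equals `1` up to radius `R + 1`, so the integrand is
`≤ B₀ + ζ_R² (e_ψ + e_χ)` on the ball, and `∫ ζ_R² (e_ψ + e_χ) ≤ c · vol{‖y‖ ≤ R + 2}` with
`vol{‖y‖ ≤ r} = r³ vol{‖y‖ ≤ 1}` and `(R + 2)³ ≤ 27R³ + 27`. -/
theorem kerrModePair_sliceEnergy_growth [Kerr.Facts] [Kerr.SliceFacts] {M a r₀ : ℝ}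
    (hMa : Kerr.IsSubextremal M a) (hrm : Kerr.rMinus M a < r₀) (hr : r₀ < Kerr.rPlus M a)
    {ν w : ℝ} {ψ χ : Kerr.region a r₀ → ℝ}
    (hψ : ContMDiff 𝓘(ℝ, E4) 𝓘(ℝ, ℝ) ∞ ψ) (hχ : ContMDiff 𝓘(ℝ, E4) 𝓘(ℝ, ℝ) ∞ χ)
    (H : ∀ x : Kerr.region a r₀, Kerr.rPlus M a < Kerr.radius a x.1 →
      (Kerr.smoothMetric M a r₀).toPseudoRiemannianMetric.dalembertian ψ x = 0 ∧
      (Kerr.smoothMetric M a r₀).toPseudoRiemannianMetric.dalembertian χ x = 0 ∧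
      mfderiv 𝓘(ℝ, E4) 𝓘(ℝ, ℝ) ψ x (Kerr.stationaryField a r₀ x) = ν * ψ x - w * χ x ∧
      mfderiv 𝓘(ℝ, E4) 𝓘(ℝ, ℝ) χ x (Kerr.stationaryField a r₀ x) = w * ψ x + ν * χ x)
    {Cb : ℝ} (hbdd : ∀ x : Kerr.region a r₀, Kerr.rPlus M a < Kerr.radius a x.1 → (x : E4) 0 ≤ 0 →
      |ψ x| ≤ Cb ∧ |χ x| ≤ Cb) :
    ∃ A B : ℝ, 0 ≤ A ∧ 0 ≤ B ∧ ∀ R : ℝ, 0 ≤ R →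
      ∫⁻ y in Metric.closedBall (0 : E3) R,
        {y : E3 | Kerr.rPlus M a < Kerr.radius a (E4.ofTimeSpace 0 y)}.indicator
          (fun y ↦ ENNReal.ofReal (coordEnergyDensity (Kerr.region a r₀) ψ (E4.ofTimeSpace 0 y) +
            coordEnergyDensity (Kerr.region a r₀) χ (E4.ofTimeSpace 0 y))) y ≤
        ENNReal.ofReal (A * R ^ 3 + B) := by
  classical
  have hM : 0 < M := hMa.pos
  have hr₀0 : 0 ≤ r₀ := hMa.rMinus_nonneg.trans hrm.le
  set rp := Kerr.rPlus M a with hrp_def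
  have hrp : 0 < rp := hMa.rPlus_pos
  set fR := Kerr.farRadius M a with hfR_def
  have hfR : 0 < fR := Kerr.farRadius_pos M a
  obtain ⟨K, hK0, hK⟩ := Kerr.exists_bound_deriv_smoothTransition
  set e : E3 → ℝ := fun y ↦ coordEnergyDensity (Kerr.region a r₀) ψ (E4.ofTimeSpace 0 y) +
    coordEnergyDensity (Kerr.region a r₀) χ (E4.ofTimeSpace 0 y) with he_def
  have he0 : ∀ y, 0 ≤ e y := fun y ↦
    add_nonneg (coordEnergyDensity_nonneg _ _ _) (coordEnergyDensity_nonneg _ _ _)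
  -- ### the near zone: a compact set inside the chart on which `e` is bounded
  set K₀ : Set E3 := Metric.closedBall (0 : E3) (fR + 2) ∩
    {y : E3 | rp ≤ Kerr.radius a (E4.ofTimeSpace 0 y)} with hK₀
  have hK₀c : IsCompact K₀ := (isCompact_closedBall _ _).inter_right
    (isClosed_le continuous_const ((Kerr.continuous_radius a).comp (E4.continuous_ofTimeSpace 0)))
  have hK₀reg : ∀ y ∈ K₀, E4.ofTimeSpace 0 y ∈ Kerr.region a r₀ := by
    intro y hy
    rw [Kerr.mem_region]
    exact max_lt (hr.trans_le hy.2) (hrp.trans_le hy.2)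
  have hcont : ContinuousOn e K₀ := by
    intro y hy
    have hc : ∀ (f : Kerr.region a r₀ → ℝ), ContMDiff 𝓘(ℝ, E4) 𝓘(ℝ, ℝ) ∞ f →
        ContinuousAt (fun y ↦ coordEnergyDensity (Kerr.region a r₀) f (E4.ofTimeSpace 0 y)) y := by
      intro f hf
      unfold coordEnergyDensity
      refine tendsto_finsetSum _ fun μ _ ↦ ?_
      have hF : ContDiffAt ℝ ∞ (Function.extend Subtype.val f 0) (E4.ofTimeSpace 0 y) :=
        contDiffAt_extend hf ⟨_, hK₀reg y hy⟩
      have h1 : ContinuousAt (fun z ↦ fderiv ℝ (Function.extend Subtype.val f 0) z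
          (EuclideanSpace.single μ (1 : ℝ))) (E4.ofTimeSpace 0 y) :=
        (contDiffAt_fderiv_apply_const_infty hF _).continuousAt
      have h2 : ContinuousAt (E4.ofTimeSpace 0) y := (E4.continuous_ofTimeSpace 0).continuousAt
      exact (ContinuousAt.comp (g := fun z ↦ fderiv ℝ (Function.extend Subtype.val f 0) z
        (EuclideanSpace.single μ (1 : ℝ))) h1 h2).pow 2
    exact ((hc ψ hψ).add (hc χ hχ)).continuousWithinAt
  obtain ⟨B₁, hB₁⟩ := hK₀c.exists_bound_of_continuousOn hcont
  set B₀ : ℝ := max B₁ 0 with hB₀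
  have hB₀0 : 0 ≤ B₀ := le_max_right _ _
  have hnear : ∀ y ∈ K₀, e y ≤ B₀ := fun y hy ↦
    ((le_abs_self _).trans ((Real.norm_eq_abs _).symm.le.trans (hB₁ y hy))).trans (le_max_left _ _)
  -- ### constants
  set cfar : ℝ := 2 * ((|ν| + |w|) * Cb) ^ 2 +
    9 / 4 * (132 * ((|ν| + |w|) * Cb) ^ 2 + 2304 * (Cb * (2 * K)) ^ 2) with hcfar
  have hcfar0 : 0 ≤ cfar := by positivity
  set V₁ : ℝ≥0∞ := volume (Metric.ball (0 : E3) 1) with hV₁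
  have hV₁top : V₁ < ⊤ := measure_ball_lt_top
  set v₁ : ℝ := V₁.toReal with hv₁
  have hv₁0 : 0 ≤ v₁ := ENNReal.toReal_nonneg
  have hvol : ∀ r : ℝ, 0 ≤ r → volume (Metric.closedBall (0 : E3) r) = ENNReal.ofReal (r ^ 3) * V₁ := by
    intro r hr'
    rw [Measure.addHaar_closedBall volume (0 : E3) hr', finrank_euclideanSpace_fin]
  have hvolreal : ∀ r : ℝ, 0 ≤ r → volume.real (Metric.closedBall (0 : E3) r) = r ^ 3 * v₁ := by
    intro r hr'
    rw [measureReal_def, hvol r hr', ENNReal.toReal_mul, ENNReal.toReal_ofReal (by positivity)]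
  refine ⟨(B₀ + 27 * cfar) * v₁, 27 * cfar * v₁, by positivity, by positivity, fun R hR ↦ ?_⟩
  -- ### the cut-off of the far zone for this `R`
  set ζ : E3 → ℝ := fun y : E3 ↦
    radialTransition (Kerr.farRadius M a + 1) 1 y * (1 - radialTransition (R + 1) 1 y) with hζ
  obtain ⟨hint, hfar⟩ := kerrModePair_cutoff_energy_le hMa hr hψ hχ H hbdd hK hR ζ hζ
  have hζ1 : ∀ y : E3, fR + 2 ≤ ‖y‖ → ‖y‖ ≤ R + 1 → ζ y = 1 := fun y h1 h2 ↦
    kerr_annularCutoff_eq_one (by rw [← hfR_def]; linarith) h2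
  -- ### the pointwise bound on the ball
  set S : Set E3 := {y : E3 | rp < Kerr.radius a (E4.ofTimeSpace 0 y)} with hS
  have hpt : ∀ y ∈ Metric.closedBall (0 : E3) R,
      S.indicator (fun y ↦ ENNReal.ofReal (e y)) y ≤
        ENNReal.ofReal B₀ + ENNReal.ofReal (ζ y ^ 2 * e y) := by
    intro y hy
    rw [Metric.mem_closedBall, dist_zero_right] at hy
    by_cases hyS : y ∈ S
    · rw [Set.indicator_of_mem hyS]
      by_cases hnear' : ‖y‖ ≤ fR + 2
      · have hyS' : rp < Kerr.radius a (E4.ofTimeSpace 0 y) := hyS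
        have hyK : y ∈ K₀ := ⟨by rw [Metric.mem_closedBall, dist_zero_right]; exact hnear',
          show rp ≤ Kerr.radius a (E4.ofTimeSpace 0 y) from hyS'.le⟩
        exact (ENNReal.ofReal_le_ofReal (hnear y hyK)).trans le_self_add
      · have h1 : ζ y = 1 := hζ1 y (le_of_lt (not_le.mp hnear')) (by linarith)
        rw [h1, one_pow, one_mul]
        exact le_add_self
    · rw [Set.indicator_of_notMem hyS]
      exact bot_le
  -- ### integrate
  have hfin : ∫⁻ y, ENNReal.ofReal (ζ y ^ 2 * e y) = ENNReal.ofReal (∫ y, ζ y ^ 2 * e y) :=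
    (ofReal_integral_eq_lintegral_ofReal hint
      (ae_of_all _ fun y ↦ mul_nonneg (sq_nonneg _) (he0 y))).symm
  calc ∫⁻ y in Metric.closedBall (0 : E3) R, S.indicator (fun y ↦ ENNReal.ofReal (e y)) y
      ≤ ∫⁻ y in Metric.closedBall (0 : E3) R,
          (ENNReal.ofReal B₀ + ENNReal.ofReal (ζ y ^ 2 * e y)) :=
        setLIntegral_mono' measurableSet_closedBall hpt
    _ = ENNReal.ofReal B₀ * volume (Metric.closedBall (0 : E3) R) +
          ∫⁻ y in Metric.closedBall (0 : E3) R, ENNReal.ofReal (ζ y ^ 2 * e y) := by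
        rw [lintegral_add_left measurable_const, setLIntegral_const, mul_comm]
    _ ≤ ENNReal.ofReal B₀ * volume (Metric.closedBall (0 : E3) R) +
          ∫⁻ y, ENNReal.ofReal (ζ y ^ 2 * e y) :=
        add_le_add le_rfl (setLIntegral_le_lintegral _ _)
    _ = ENNReal.ofReal B₀ * (ENNReal.ofReal (R ^ 3) * V₁) + ENNReal.ofReal (∫ y, ζ y ^ 2 * e y) := by
        rw [hvol R hR, hfin]
    _ ≤ ENNReal.ofReal B₀ * (ENNReal.ofReal (R ^ 3) * V₁) +
          ENNReal.ofReal (cfar * ((R + 2) ^ 3 * v₁)) := by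
        gcongr
        rw [← hvolreal (R + 2) (by linarith)]
        exact hfar
    _ = ENNReal.ofReal (B₀ * (R ^ 3 * v₁) + cfar * ((R + 2) ^ 3 * v₁)) := by
        rw [← ENNReal.ofReal_toReal hV₁top.ne, ← hv₁, ← ENNReal.ofReal_mul (by positivity),
          ← ENNReal.ofReal_mul hB₀0, ← ENNReal.ofReal_add (by positivity) (by positivity)]
    _ ≤ ENNReal.ofReal ((B₀ + 27 * cfar) * v₁ * R ^ 3 + 27 * cfar * v₁) := by
        refine ENNReal.ofReal_le_ofReal ?_
        have h3 := kerr_add_two_pow_three_le hR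
        have hcv : 0 ≤ cfar * v₁ := mul_nonneg hcfar0 hv₁0
        nlinarith [mul_le_mul_of_nonneg_left h3 hcv]

end Summit.FinalStateConjecture.FinalStateConjecture.Theorems

end
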